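import Summits.AtomisticToContinuum.Crystallization.Theorems.GappedShellCensusCleanLimitsHaveWindowsLayeredAtlas
import Literature.Geometry.DiscreteGeometry.KissingPatterns

/-!
# Exactly layered shells ⇒ exactly layered set, file 2: in-plane hexagon completion

Crux `GappedShellCensus.CleanLimitsHaveWindows` (stmt-AtomisticToContinuum-15932), line `Sketch`; registered helper
`stub_inplaneHexagon` of the stub `stub_layeredOfExactShells` (T3a-ii). At a site `p` with exact shell
`p + A·slotX(a', h⁺, h⁻)` (rigid if cubic) the in-plane neighbour `q = p + A u` has in ITS exact shell the five known
points `p`, `p + A (u - v)`, `p + A v`, the upper cap point `p + A (w + h⁺e₃)` and a lower cap point of `p`. In the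
integer atlas (`…LayeredAtlas`) their mutual distances become adjacencies / radius-class equalities in `q`'s model,
and a finite enumeration (`laCompletionOK`, `decide`) shows that the slots of the three in-plane ones have antipodes
in `q`'s model: these are the far hexagon points `p + 2A u`, `p + A (u + v)`, `p + A (2u - v)`, hence in `Z`.
-/

noncomputable section

namespace Summit.AtomisticToContinuum.Crystallization.Theorems.CleanHull

open Literature.MathematicalPhysics.StatisticalMechanics Literature.Geometry.DiscreteGeometry

/-- Do the levels `l, m ∈ {0, 1, -1}` have equal radii, if `e = (R 1 = R 0, R (-1) = R 0, R 1 = R (-1))`? [folklore] -/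
def laSame (e : Bool × Bool × Bool) (l m : ℤ) : Bool :=
  if l = m then true else if l + m = 1 then e.1 else if l + m = -1 then e.2.1 else e.2.2

/-- The level whose radius is the length of the edge between the adjacent codes `c`, `d`. [folklore] -/
def laLvl (c d : ℤ × ℤ × ℤ) : ℤ := if c.2.2 = d.2.2 then 0 else if c.2.2 = 0 then d.2.2 else c.2.2

/-- Componentwise negation of a code. [folklore] -/
def laNeg (c : ℤ × ℤ × ℤ) : ℤ × ℤ × ℤ := (-c.1, -c.2.1, -c.2.2)

/-- The polytope neighbours of slot `i` in the model of type `t`. [folklore] -/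
def laNbrs (t : Bool) (i : Fin 12) : List (Fin 12) :=
  (List.finRange 12).filter fun j => laAdj (laCode t i) (laCode t j)

/-- Hypotheses of the completion enumeration for the codes `ci, cj, cl, cm, cn` (in `q`'s model) of the known
points `p`, `p + A (u - v)`, `p + A v`, upper cap, lower cap; `t` = type of `p`, `e` = radius pattern of `q`. [folklore] -/
def laHypOK (t : Bool) (e : Bool × Bool × Bool) (ci cj cl cm cn : ℤ × ℤ × ℤ) : Bool :=
  decide (laAdj cl cm = true ∧ (t = true → laAdj cj cn = true) ∧ (t = false → laAdj cl cn = true) ∧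
    cj ≠ cm ∧ cj ≠ cn ∧ cl ≠ cn ∧ cm ≠ cn ∧ laSame e (laLvl ci cn) cn.2.2 = true ∧
    (t = true → ¬ (laSame e cm.2.2 ci.2.2 = true ∧ laSame e cn.2.2 ci.2.2 = true)) ∧
    ¬ (cj.2.2 ≠ cl.2.2 ∧ (cj.2.2 = 0 ∨ cl.2.2 = 0) ∧ laQn cj cl = 12))

/-- Conclusion of the enumeration: `ci, cj, cl` are at level `0`, or `q` is cubic with three equal radii. [folklore] -/
def laConclOK (t' : Bool) (e : Bool × Bool × Bool) (ci cj cl : ℤ × ℤ × ℤ) : Bool :=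
  decide ((ci.2.2 = 0 ∧ cj.2.2 = 0 ∧ cl.2.2 = 0) ∨ (t' = true ∧ e.1 = true ∧ e.2.1 = true))

/-- **The in-plane completion enumeration** over the slot `i` of `p` and its neighbours `j, l, m, n`. [folklore] -/
def laCompletionOK (t t' : Bool) (e : Bool × Bool × Bool) : Bool :=
  (List.finRange 12).all fun i => (laNbrs t' i).all fun j => (laNbrs t' i).all fun l =>
    (laNbrs t' i).all fun m => (laNbrs t' i).all fun n =>
      !laHypOK t e (laCode t' i) (laCode t' j) (laCode t' l) (laCode t' m) (laCode t' n) ||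
        laConclOK t' e (laCode t' i) (laCode t' j) (laCode t' l)

/-- The enumeration passes. [folklore] -/
theorem laCompletionOK_all (t t' e₁ e₂ e₃ : Bool) : laCompletionOK t t' (e₁, e₂, e₃) = true := by
  revert t t' e₁ e₂ e₃
  decide +kernel

/-- Specialising the enumeration to one configuration. [folklore] -/
theorem laCompletionOK_spec (t t' : Bool) (e : Bool × Bool × Bool) (i j l m n : Fin 12)
    (hj : laAdj (laCode t' i) (laCode t' j) = true) (hl : laAdj (laCode t' i) (laCode t' l) = true)
    (hm : laAdj (laCode t' i) (laCode t' m) = true) (hn : laAdj (laCode t' i) (laCode t' n) = true)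
    (hh : laHypOK t e (laCode t' i) (laCode t' j) (laCode t' l) (laCode t' m) (laCode t' n) = true) :
    laConclOK t' e (laCode t' i) (laCode t' j) (laCode t' l) = true := by
  obtain ⟨e₁, e₂, e₃⟩ := e
  have H := laCompletionOK_all t t' e₁ e₂ e₃
  have mem : ∀ k, laAdj (laCode t' i) (laCode t' k) = true → k ∈ laNbrs t' i := fun k hk =>
    List.mem_filter.2 ⟨List.mem_finRange k, hk⟩
  unfold laCompletionOK at H
  rw [List.all_eq_true] at H
  have H := H i (List.mem_finRange i); rw [List.all_eq_true] at H
  have H := H j (mem j hj); rw [List.all_eq_true] at H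
  have H := H l (mem l hl); rw [List.all_eq_true] at H
  have H := H m (mem m hm); rw [List.all_eq_true] at H
  have H := H n (mem n hn)
  rw [hh] at H
  simpa using H

/-- Faithfulness of the radius-pattern encoding. [folklore] -/
theorem laSame_iff (R : ℤ → ℝ) {e : Bool × Bool × Bool}
    (he : e = (decide (R 1 = R 0), decide (R (-1) = R 0), decide (R 1 = R (-1)))) {l m : ℤ}
    (hl : l = 0 ∨ l = 1 ∨ l = -1) (hm : m = 0 ∨ m = 1 ∨ m = -1) : laSame e l m = true ↔ R l = R m := by
  subst he
  rcases hl with rfl | rfl | rfl <;> rcases hm with rfl | rfl | rfl <;> simp [laSame, eq_comm]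

/-- Level-`0` codes of either model, and all codes of the cubic model, have negatives in the model. [folklore] -/
theorem laCode_neg_exists (t : Bool) (i : Fin 12) (h : (laCode t i).2.2 = 0 ∨ t = true) :
    ∃ i' : Fin 12, laCode t i' = laNeg (laCode t i) := by
  revert h i t
  decide

/-- Negating a code negates its point when the heights allow it. [folklore] -/
theorem laPt_laNeg (a' kp km : ℝ) (c : ℤ × ℤ × ℤ) (h : laHt kp km (-c.2.2) = -laHt kp km c.2.2) :
    laPt a' kp km (laNeg c) = -laPt a' kp km c := by
  simp only [laPt, laNeg, Int.cast_neg, h, neg_div, neg_smul, neg_add]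

/-- Levels of codes are `0, 1, -1`. [folklore] -/
theorem laCode_lv (t : Bool) (i : Fin 12) :
    (laCode t i).2.2 = 0 ∨ (laCode t i).2.2 = 1 ∨ (laCode t i).2.2 = -1 := by
  revert i t
  decide

/-- Edge levels of pairs of codes are `0, 1, -1`. [folklore] -/
theorem laLvl_lv (t : Bool) (i j : Fin 12) : laLvl (laCode t i) (laCode t j) = 0 ∨
    laLvl (laCode t i) (laCode t j) = 1 ∨ laLvl (laCode t i) (laCode t j) = -1 := by
  revert i j t
  decide

/-- Code facts about the five known points (`kn` = code in `p`'s model of the lower cap point from `q`). [folklore] -/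
theorem la_known_code_facts (t : Bool) (kn : Fin 12) (hkn : kn = if t then 9 else 10) :
    laAdj (laCode t 1) (laCode t 3) = true ∧ laAdj (laCode t 1) (laCode t 5) = true ∧
    laAdj (laCode t 1) (laCode t 7) = true ∧ laAdj (laCode t 1) (laCode t kn) = true ∧
    laAdj (laCode t 5) (laCode t 7) = true ∧ laAdj (laCode t 3) (laCode t kn) = t ∧
    laAdj (laCode t 5) (laCode t kn) = !t ∧ laLvl (laCode t 1) (laCode t kn) = -1 ∧ (laCode t kn).2.2 = -1 ∧
    (laCode t 7).2.2 = 1 ∧ (laCode t 1).2.2 = 0 ∧ laQn (laCode t 3) (laCode t 5) = 27 ∧ (laCode t 3).2.2 = 0 ∧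
    (laCode t 5).2.2 = 0 ∧ (1 : Fin 12) ≠ kn ∧ (3 : Fin 12) ≠ kn ∧ (5 : Fin 12) ≠ kn ∧ (7 : Fin 12) ≠ kn := by
  cases t <;> subst hkn <;> decide

/-- Slot identities about the five known points (`kq` = slot in `p`'s shell of the lower cap point). [folklore] -/
theorem la_known_slot_facts (t : Bool) (kn kq : Fin 12) (hkn : kn = if t then 9 else 10)
    (hkq : kq = if t then 10 else 9) (a' kp km : ℝ) :
    laSlot t a' kp km 0 = triangularVec₁ a' ∧ laSlot t a' kp km 1 = -triangularVec₁ a' ∧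
    laSlot t a' kp km 3 = -triangularVec₂ a' ∧ laSlot t a' kp km 5 = triangularVec₂ a' - triangularVec₁ a' ∧
    laSlot t a' kp km 4 - laSlot t a' kp km 0 = laSlot t a' kp km 3 ∧
    laSlot t a' kp km 2 - laSlot t a' kp km 0 = laSlot t a' kp km 5 ∧
    laSlot t a' kp km 6 - laSlot t a' kp km 0 = laSlot t a' kp km 7 ∧
    laSlot t a' kp km kq - laSlot t a' kp km 0 = laSlot t a' kp km kn := by
  cases t <;> subst hkn hkq <;> simp [laSlot, slotC, slotH]

/-- Squared radius of level `l`: `a'²` at level `0`, `a'²/3 + h±²` at level `±1`. [folklore] -/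
def laRsq (a' kp km : ℝ) (l : ℤ) : ℝ := (if l = 0 then a' ^ 2 else a' ^ 2 / 3) + laHt kp km l ^ 2

/-- The three squared radii. [folklore] -/
theorem laRsq_values (a' kp km : ℝ) :
    laRsq a' kp km 0 = a' ^ 2 ∧ laRsq a' kp km 1 = a' ^ 2 / 3 + kp ^ 2 ∧ laRsq a' kp km (-1) = a' ^ 2 / 3 + km ^ 2 := by
  simp [laRsq, laHt]

/-- Squared norm of a slot = squared radius of its level. [folklore] -/
theorem norm_laPt_code_sq (a' kp km : ℝ) (t : Bool) (i : Fin 12) :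
    ‖laPt a' kp km (laCode t i)‖ ^ 2 = laRsq a' kp km (laCode t i).2.2 := by
  rw [norm_laPt_sq, laRsq]
  rcases laCode_level t i with ⟨hl, hq⟩ | ⟨hl, hq⟩ | ⟨hl, hq⟩ <;>
  · have hq' := congrArg (Int.cast (R := ℝ)) hq
    push_cast at hq'
    rw [hq', hl]
    simp <;> ring

/-- Squared distance of adjacent slots = squared radius of the edge level. [folklore] -/
theorem dist_laPt_sq_of_adj (a' kp km : ℝ) (t : Bool) (i j : Fin 12) (h : laAdj (laCode t i) (laCode t j) = true) :
    dist (laPt a' kp km (laCode t i)) (laPt a' kp km (laCode t j)) ^ 2 =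
      laRsq a' kp km (laLvl (laCode t i) (laCode t j)) := by
  rw [dist_laPt_sq, laRsq, laLvl]
  obtain ⟨h0, -, -⟩ := laHt_values kp km
  rcases (laAdj_iff _ _).1 h with ⟨hl, hq⟩ | ⟨hl, h0', hq⟩
  · rw [hq, hl, sub_self, if_pos rfl, if_pos rfl, h0]
    push_cast; ring
  · rw [hq, if_neg hl]
    rcases h0' with hz | hz
    · have hne : (laCode t j).2.2 ≠ 0 := fun h' => hl (hz.trans h'.symm)
      rw [if_pos hz, hz, if_neg hne, h0]
      push_cast; ring
    · have hne : (laCode t i).2.2 ≠ 0 := fun h' => hl (h'.trans hz.symm)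
      rw [if_neg hne, hz, if_neg hne, h0]
      push_cast; ring

section Band

variable {a a' kp km : ℝ}
  (hb : 0 < a ∧ 0 < kp ∧ 0 < km ∧ a * (1 - 1 / 50) ≤ a' ∧ a' ≤ a * (1 + 1 / 50) ∧
      (a * (1 - 1 / 50)) ^ 2 ≤ a' ^ 2 / 3 + kp ^ 2 ∧ a' ^ 2 / 3 + kp ^ 2 ≤ (a * (1 + 1 / 50)) ^ 2 ∧
      (a * (1 - 1 / 50)) ^ 2 ≤ a' ^ 2 / 3 + km ^ 2 ∧ a' ^ 2 / 3 + km ^ 2 ≤ (a * (1 + 1 / 50)) ^ 2)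

include hb

/-- Slots are at positive distance at most `1.02a` from the centre (band). [folklore] -/
theorem la_norm_bounds (t : Bool) (i : Fin 12) :
    0 < ‖laPt a' kp km (laCode t i)‖ ∧ ‖laPt a' kp km (laCode t i)‖ ≤ a * (1 + 1 / 50) := by
  obtain ⟨ha, hkp, hkm, hlo, hhi, hplo, hphi, hmlo, hmhi⟩ := hb
  have h098 : 0 < a * (1 - 1 / 50) := by positivity
  have h102 : 0 ≤ a * (1 + 1 / 50) := by positivity
  have ha' : 0 < a' := by linarith
  rcases la_norm_code (kp := kp) (km := km) ha' t i with ⟨-, h⟩ | ⟨-, h⟩ | ⟨-, h⟩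
  · rw [h]; exact ⟨ha', hhi⟩
  all_goals
    refine ⟨h098.trans_le ((pow_le_pow_iff_left₀ h098.le (norm_nonneg _) two_ne_zero).1 ?_),
      (pow_le_pow_iff_left₀ (norm_nonneg _) h102 two_ne_zero).1 ?_⟩ <;> rw [h] <;> assumption

/-- Distinct slots are at positive distance (band). [folklore] -/
theorem la_dist_pos (t : Bool) (i j : Fin 12) (hij : i ≠ j) :
    0 < dist (laPt a' kp km (laCode t i)) (laPt a' kp km (laCode t j)) := by
  have ha : 0 < a := hb.1
  have ha' : 0 < a' := by linarith [hb.2.2.2.1, show 0 < a * (1 - 1 / 50) by positivity]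
  by_cases h : laAdj (laCode t i) (laCode t j) = true
  · rcases la_dist_of_adj (kp := kp) (km := km) ha' (laCode_lv t i) (laCode_lv t j) h with
      ⟨-, hd⟩ | ⟨-, -, hd⟩ | ⟨-, -, hd⟩
    · rw [hd]; exact ha'
    · exact lt_of_le_of_ne dist_nonneg fun h0 => by rw [← h0] at hd; nlinarith [hb.2.1]
    · exact lt_of_le_of_ne dist_nonneg fun h0 => by rw [← h0] at hd; nlinarith [hb.2.2.1]
  · have := la_lt_dist_of_not_adj hb t i j hij (by simpa using h)
    linarith [show 0 < a * (1 + 1 / 50) by positivity]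

/-- A level-`0` and a level-`±1` slot with in-plane form `12` are within `√2 · 1.02a` of each other. [folklore] -/
theorem la_dist_sq_mixed (t : Bool) (j l : Fin 12)
    (h0 : (laCode t j).2.2 = 0 ∨ (laCode t l).2.2 = 0) (hq : laQn (laCode t j) (laCode t l) = 12) :
    dist (laPt a' kp km (laCode t j)) (laPt a' kp km (laCode t l)) ^ 2 ≤ 2 * (a * (1 + 1 / 50)) ^ 2 := by
  obtain ⟨ha, hkp, hkm, hlo, hhi, hplo, hphi, hmlo, hmhi⟩ := hb
  have ha2 : a' ^ 2 ≤ (a * (1 + 1 / 50)) ^ 2 := pow_le_pow_left₀ (by linarith) hhi 2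
  have hH : ∀ k, laHt kp km (laCode t k).2.2 ^ 2 ≤ (a * (1 + 1 / 50)) ^ 2 - a' ^ 2 / 3 := fun k => by
    rcases laCode_lv t k with h | h | h <;> rw [h] <;> simp [laHt] <;> nlinarith
  obtain ⟨hz, -, -⟩ := laHt_values kp km
  rw [dist_laPt_sq, hq]
  push_cast
  rcases h0 with h | h
  · rw [h, hz, zero_sub, neg_sq]; nlinarith [hH l]
  · rw [h, hz, sub_zero]; nlinarith [hH j]

/-- **Transfer between the two frames.** Known points with equal images have equal mutual distances, so (band at
both sites) distinctness and adjacency of their codes transfer from `p`'s model to `q`'s model. [folklore] -/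
theorem la_transfer {b kp' km' : ℝ} (hb' : 0 < a ∧ 0 < kp' ∧ 0 < km' ∧ a * (1 - 1 / 50) ≤ b ∧
      b ≤ a * (1 + 1 / 50) ∧ (a * (1 - 1 / 50)) ^ 2 ≤ b ^ 2 / 3 + kp' ^ 2 ∧ b ^ 2 / 3 + kp' ^ 2 ≤ (a * (1 + 1 / 50)) ^ 2 ∧
      (a * (1 - 1 / 50)) ^ 2 ≤ b ^ 2 / 3 + km' ^ 2 ∧ b ^ 2 / 3 + km' ^ 2 ≤ (a * (1 + 1 / 50)) ^ 2)
    {A A' : EuclideanSpace ℝ (Fin 3) →ₗᵢ[ℝ] EuclideanSpace ℝ (Fin 3)} {t t' : Bool} {i₁ i₂ k₁ k₂ : Fin 12}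
    (h₁ : A' (laPt b kp' km' (laCode t' i₁)) = A (laPt a' kp km (laCode t k₁)))
    (h₂ : A' (laPt b kp' km' (laCode t' i₂)) = A (laPt a' kp km (laCode t k₂))) (hk : k₁ ≠ k₂) :
    i₁ ≠ i₂ ∧ laAdj (laCode t' i₁) (laCode t' i₂) = laAdj (laCode t k₁) (laCode t k₂) ∧
      dist (laPt b kp' km' (laCode t' i₁)) (laPt b kp' km' (laCode t' i₂)) =
        dist (laPt a' kp km (laCode t k₁)) (laPt a' kp km (laCode t k₂)) := by
  have hd : dist (laPt b kp' km' (laCode t' i₁)) (laPt b kp' km' (laCode t' i₂)) =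
      dist (laPt a' kp km (laCode t k₁)) (laPt a' kp km (laCode t k₂)) := by
    rw [← A'.dist_map, h₁, h₂, A.dist_map]
  have hpos := la_dist_pos hb t k₁ k₂ hk
  have hne : i₁ ≠ i₂ := by
    rintro rfl
    rw [dist_self] at hd
    linarith
  refine ⟨hne, ?_, hd⟩
  rw [Bool.eq_iff_iff, ← la_dist_le_iff_adj hb' t' i₁ i₂ hne, ← la_dist_le_iff_adj hb t k₁ k₂ hk, hd]

end Band

/-- **In-plane hexagon completion, both types at once** (`t` = type of `p`, rigidity required for cubic type;
`kn`, `kq` = code relative to `q` and slot in `p`'s shell of the lower cap point used). [folklore] -/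
theorem inplaneHexagon_of_type (Z : Set (EuclideanSpace ℝ (Fin 3))) (a : ℝ) (ha : 0 < a)
    (hgap : ∀ y ∈ Z, ∀ w ∈ Z, w ≠ y → a * (1 - 1 / 50) ≤ dist y w ∧
      (dist y w ≤ a * (1 + 1 / 50) ∨ a * (63 / 50) ≤ dist y w))
    (hexact : ∀ p ∈ Z, ∃ (a' hp' hm' : ℝ) (A : EuclideanSpace ℝ (Fin 3) →ₗᵢ[ℝ] EuclideanSpace ℝ (Fin 3)),
      0 < a' ∧ 0 < hp' ∧ 0 < hm' ∧
      ((bondShell a Z p = Set.range fun k : Fin 12 => p + A (slotC a' hp' hm' k)) ∨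
       (bondShell a Z p = Set.range fun k : Fin 12 => p + A (slotH a' hp' hm' k))))
    (p : EuclideanSpace ℝ (Fin 3)) (hp : p ∈ Z) (a' hp' hm' : ℝ)
    (A : EuclideanSpace ℝ (Fin 3) →ₗᵢ[ℝ] EuclideanSpace ℝ (Fin 3)) (ha' : 0 < a') (hhp : 0 < hp') (hhm : 0 < hm')
    (t : Bool) (kn kq : Fin 12) (hkn : kn = if t then 9 else 10) (hkq : kq = if t then 10 else 9)
    (hS : bondShell a Z p = Set.range fun k : Fin 12 => p + A (laSlot t a' hp' hm' k))
    (hrig : t = true → ¬ (3 * hp' ^ 2 = 2 * a' ^ 2 ∧ 3 * hm' ^ 2 = 2 * a' ^ 2)) :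
    p + A ((2 : ℝ) • triangularVec₁ a') ∈ Z ∧ p + A (triangularVec₁ a' + triangularVec₂ a') ∈ Z ∧
      p + A ((2 : ℝ) • triangularVec₁ a' - triangularVec₂ a') ∈ Z := by
  obtain ⟨f0, f1, f3, f5, d4, d2, d6, dq⟩ := la_known_slot_facts t kn kq hkn hkq a' hp' hm'
  obtain ⟨a13, a15, a17, a1n, a57, a3n, a5n, lv1n, lvn, lv7, lv1, q35, lv3, lv5, ne1, ne3, ne5, ne7⟩ :=
    la_known_code_facts t kn hkn
  -- the band at `p`, the points of `p`'s shell, the site `q`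
  have hSor : (bondShell a Z p = Set.range fun k : Fin 12 => p + A (slotC a' hp' hm' k)) ∨
      (bondShell a Z p = Set.range fun k : Fin 12 => p + A (slotH a' hp' hm' k)) := by
    cases t
    · exact Or.inr hS
    · exact Or.inl hS
  have hb : 0 < a ∧ 0 < hp' ∧ 0 < hm' ∧ _ :=
    ⟨ha, hhp, hhm, stub_exactBand Z a ha hgap p hp a' hp' hm' A ha' hhp hhm hSor⟩
  have hP : ∀ k, p + A (laSlot t a' hp' hm' k) ∈ Z := fun k => by
    have h : p + A (laSlot t a' hp' hm' k) ∈ bondShell a Z p := hS ▸ ⟨k, rfl⟩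
    exact h.1
  set q := p + A (laSlot t a' hp' hm' 0) with hq
  -- the exact shell of `q` and the band at `q`
  obtain ⟨b, kp, km, A', hb0, hkp, hkm, hSq'⟩ := hexact q (hP 0)
  obtain ⟨t', hSq⟩ : ∃ t' : Bool, bondShell a Z q = Set.range fun k : Fin 12 => q + A' (laSlot t' b kp km k) := by
    rcases hSq' with h | h
    · exact ⟨true, h⟩
    · exact ⟨false, h⟩
  have hbq : 0 < a ∧ 0 < kp ∧ 0 < km ∧ _ :=
    ⟨ha, hkp, hkm, stub_exactBand Z a ha hgap q (hP 0) b kp km A' hb0 hkp hkm hSq'⟩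
  have hQ : ∀ k, q + A' (laSlot t' b kp km k) ∈ Z := fun k => by
    have h : q + A' (laSlot t' b kp km k) ∈ bondShell a Z q := hSq ▸ ⟨k, rfl⟩
    exact h.1
  -- known points of `Z` within bond range of `q` are slots of `q`'s shell
  have idx : ∀ (Y : EuclideanSpace ℝ (Fin 3)) (k : Fin 12), Y ∈ Z → Y - q = A (laSlot t a' hp' hm' k) →
      ∃ i : Fin 12, A' (laPt b kp km (laCode t' i)) = A (laPt a' hp' hm' (laCode t k)) := by
    intro Y k hY hYq
    rw [laSlot_eq_laPt] at hYq
    obtain ⟨h1, h2⟩ := la_norm_bounds hb t k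
    have hdY : dist q Y = ‖laPt a' hp' hm' (laCode t k)‖ := by rw [dist_comm, dist_eq_norm, hYq, A.norm_map]
    have hne : Y ≠ q := fun h => by rw [h, dist_self] at hdY; exact h1.ne hdY
    have hmem : Y ∈ bondShell a Z q := ⟨hY, hne, by rw [hdY]; exact h2⟩
    rw [hSq] at hmem
    obtain ⟨i, hi⟩ := hmem
    exact ⟨i, by rw [← laSlot_eq_laPt, ← hYq, ← hi, add_sub_cancel_left]⟩
  obtain ⟨i, hi⟩ := idx p 1 hp (by rw [hq, f0, f1, A.map_neg]; abel)
  obtain ⟨j, hj⟩ := idx _ 3 (hP 4) (by rw [hq, ← d4, A.map_sub]; abel)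
  obtain ⟨l, hl⟩ := idx _ 5 (hP 2) (by rw [hq, ← d2, A.map_sub]; abel)
  obtain ⟨m, hm⟩ := idx _ 7 (hP 6) (by rw [hq, ← d6, A.map_sub]; abel)
  obtain ⟨n, hn⟩ := idx _ kn (hP kq) (by rw [hq, ← dq, A.map_sub]; abel)
  -- transfer of distinctness / adjacency / distances / norms
  have Tij := la_transfer hb hbq hi hj (by decide)
  have Til := la_transfer hb hbq hi hl (by decide)
  have Tim := la_transfer hb hbq hi hm (by decide)
  have Tin := la_transfer hb hbq hi hn ne1
  have Tjl := la_transfer hb hbq hj hl (by decide)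
  have Tjm := la_transfer hb hbq hj hm (by decide)
  have Tjn := la_transfer hb hbq hj hn ne3
  have Tlm := la_transfer hb hbq hl hm (by decide)
  have Tln := la_transfer hb hbq hl hn ne5
  have Tmn := la_transfer hb hbq hm hn ne7
  have Nrm : ∀ {r k : Fin 12}, A' (laPt b kp km (laCode t' r)) = A (laPt a' hp' hm' (laCode t k)) →
      laRsq b kp km (laCode t' r).2.2 = laRsq a' hp' hm' (laCode t k).2.2 := fun h => by
    rw [← norm_laPt_code_sq, ← norm_laPt_code_sq, ← A'.norm_map, h, A.norm_map]
  obtain ⟨v0, v1, v2⟩ := laRsq_values a' hp' hm'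
  -- the radius pattern of `q`'s model and the hypotheses of the enumeration
  set e : Bool × Bool × Bool := (decide (laRsq b kp km 1 = laRsq b kp km 0),
    decide (laRsq b kp km (-1) = laRsq b kp km 0), decide (laRsq b kp km 1 = laRsq b kp km (-1))) with he
  have inj : ∀ {r s : Fin 12}, r ≠ s → laCode t' r ≠ laCode t' s := fun h h' => h (laCode_injective t' h')
  have hyp : laHypOK t e (laCode t' i) (laCode t' j) (laCode t' l) (laCode t' m) (laCode t' n) = true := by
    rw [laHypOK, decide_eq_true_eq]
    refine ⟨Tlm.2.1.trans a57, fun ht => by rw [Tjn.2.1, a3n, ht], fun ht => by rw [Tln.2.1, a5n, ht]; rfl,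
      inj Tjm.1, inj Tjn.1, inj Tln.1, inj Tmn.1, ?_, ?_, ?_⟩
    · rw [laSame_iff (laRsq b kp km) he (laLvl_lv t' i n) (laCode_lv t' n),
        ← dist_laPt_sq_of_adj b kp km t' i n (Tin.2.1.trans a1n), Tin.2.2,
        dist_laPt_sq_of_adj a' hp' hm' t 1 kn a1n, lv1n, Nrm hn, lvn]
    · rintro ht ⟨h1, h2⟩
      rw [laSame_iff (laRsq b kp km) he (laCode_lv t' m) (laCode_lv t' i), Nrm hm, Nrm hi, lv7, lv1, v1, v0] at h1
      rw [laSame_iff (laRsq b kp km) he (laCode_lv t' n) (laCode_lv t' i), Nrm hn, Nrm hi, lvn, lv1, v2, v0] at h2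
      exact hrig ht ⟨by linarith, by linarith⟩
    · rintro ⟨-, h0, h12⟩
      have h := la_dist_sq_mixed hbq t' j l h0 h12
      rw [Tjl.2.2, dist_laPt_sq, q35, lv3, lv5, sub_self] at h
      push_cast at h
      have h098 : 0 ≤ a * (1 - 1 / 50) := by positivity
      linarith [pow_le_pow_left₀ h098 hb.2.2.2.1 2, pow_pos ha 2]
  -- the enumeration: antipodes of the slots `i, j, l` exist in `q`'s model
  have hc := laCompletionOK_spec t t' e i j l m n (Tij.2.1.trans a13) (Til.2.1.trans a15) (Tim.2.1.trans a17)
    (Tin.2.1.trans a1n) hyp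
  rw [laConclOK, decide_eq_true_eq] at hc
  have anti : ∀ r : Fin 12, (r = i ∨ r = j ∨ r = l) →
      ∃ r' : Fin 12, laPt b kp km (laCode t' r') = -laPt b kp km (laCode t' r) := by
    intro r hr
    obtain ⟨r', hr', hh⟩ : ∃ r' : Fin 12, laCode t' r' = laNeg (laCode t' r) ∧
        laHt kp km (-(laCode t' r).2.2) = -laHt kp km (laCode t' r).2.2 := by
      rcases hc with ⟨h0i, h0j, h0l⟩ | ⟨ht', e1, e2⟩
      · have h0 : (laCode t' r).2.2 = 0 := by rcases hr with rfl | rfl | rfl <;> assumption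
        obtain ⟨r', hr'⟩ := laCode_neg_exists t' r (Or.inl h0)
        exact ⟨r', hr', by rw [h0]; simp [laHt]⟩
      · obtain ⟨r', hr'⟩ := laCode_neg_exists t' r (Or.inr ht')
        obtain ⟨w0, w1, w2⟩ := laRsq_values b kp km
        have e1' : laRsq b kp km 1 = laRsq b kp km 0 := of_decide_eq_true e1
        have e2' : laRsq b kp km (-1) = laRsq b kp km 0 := of_decide_eq_true e2
        rw [w1, w0] at e1'
        rw [w2, w0] at e2'
        have hk : kp = km := (pow_left_inj₀ hkp.le hkm.le two_ne_zero).1 (by linarith)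
        refine ⟨r', hr', ?_⟩
        rw [hk]
        rcases laCode_lv t' r with h | h | h <;> rw [h] <;> simp [laHt]
    exact ⟨r', by rw [hr', laPt_laNeg _ _ _ _ hh]⟩
  have mem : ∀ (r k : Fin 12), A' (laPt b kp km (laCode t' r)) = A (laPt a' hp' hm' (laCode t k)) →
      (∃ r' : Fin 12, laPt b kp km (laCode t' r') = -laPt b kp km (laCode t' r)) →
      q - A (laSlot t a' hp' hm' k) ∈ Z := by
    rintro r k hrk ⟨r', hr'⟩
    have h := hQ r'
    rwa [laSlot_eq_laPt, hr', A'.map_neg, hrk, ← laSlot_eq_laPt, ← sub_eq_add_neg] at h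
  refine ⟨?_, ?_, ?_⟩
  · convert mem i 1 hi (anti i (Or.inl rfl)) using 1
    rw [hq, f0, f1, A.map_neg, A.map_smul, two_smul]; abel
  · convert mem j 3 hj (anti j (Or.inr (Or.inl rfl))) using 1
    rw [hq, f0, f3, A.map_neg, A.map_add]; abel
  · convert mem l 5 hl (anti l (Or.inr (Or.inr rfl))) using 1
    rw [hq, f0, f5, A.map_sub, A.map_sub, A.map_smul, two_smul]; abel

/-- F4. **In-plane hexagon completion.** At a rigid site (hexagonal type, or cubic type with not both heights
ideal) with frame `A`, the in-plane neighbour `q = p + A u` has its three far hexagon points `q + A u`, `q + A v`,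
`q + A (u - v)` in `Z`. [folklore] -/
theorem stub_inplaneHexagon (Z : Set (EuclideanSpace ℝ (Fin 3))) (a : ℝ) (ha : 0 < a)
    (hgap : ∀ y ∈ Z, ∀ w ∈ Z, w ≠ y → a * (1 - 1 / 50) ≤ dist y w ∧
      (dist y w ≤ a * (1 + 1 / 50) ∨ a * (63 / 50) ≤ dist y w))
    (hexact : ∀ p ∈ Z, ∃ (a' hp' hm' : ℝ) (A : EuclideanSpace ℝ (Fin 3) →ₗᵢ[ℝ] EuclideanSpace ℝ (Fin 3)),
      0 < a' ∧ 0 < hp' ∧ 0 < hm' ∧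
      ((bondShell a Z p = Set.range fun k : Fin 12 => p + A (slotC a' hp' hm' k)) ∨
       (bondShell a Z p = Set.range fun k : Fin 12 => p + A (slotH a' hp' hm' k))))
    (p : EuclideanSpace ℝ (Fin 3)) (hp : p ∈ Z) (a' hp' hm' : ℝ)
    (A : EuclideanSpace ℝ (Fin 3) →ₗᵢ[ℝ] EuclideanSpace ℝ (Fin 3)) (ha' : 0 < a') (hhp : 0 < hp') (hhm : 0 < hm')
    (hS : ((bondShell a Z p = Set.range fun k : Fin 12 => p + A (slotC a' hp' hm' k)) ∧
        ¬ (3 * hp' ^ 2 = 2 * a' ^ 2 ∧ 3 * hm' ^ 2 = 2 * a' ^ 2)) ∨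
      (bondShell a Z p = Set.range fun k : Fin 12 => p + A (slotH a' hp' hm' k))) :
    p + A ((2 : ℝ) • triangularVec₁ a') ∈ Z ∧ p + A (triangularVec₁ a' + triangularVec₂ a') ∈ Z ∧
      p + A ((2 : ℝ) • triangularVec₁ a' - triangularVec₂ a') ∈ Z := by
  rcases hS with ⟨hC, hrig⟩ | hH
  · exact inplaneHexagon_of_type Z a ha hgap hexact p hp a' hp' hm' A ha' hhp hhm true 9 10 rfl rfl hC fun _ => hrig
  · exact inplaneHexagon_of_type Z a ha hgap hexact p hp a' hp' hm' A ha' hhp hhm false 10 9 rfl rfl hH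
      fun h => absurd h Bool.false_ne_true

end Summit.AtomisticToContinuum.Crystallization.Theorems.CleanHull

end
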